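import Summits.ResolutionOfSingularities.ResolutionOfSingularities.Theorems.FrobeniusClosingPatchingRelPerfectMonomialSumNodup
import Summits.ResolutionOfSingularities.ResolutionOfSingularities.Theorems.FrobeniusClosingPatchingRelPerfectMonomialPolyhedraGameMarked
import Summits.ResolutionOfSingularities.ResolutionOfSingularities.Theorems.FrobeniusClosingPatchingRelPerfectMonomialFormat
import Summits.ResolutionOfSingularities.ResolutionOfSingularities.Theorems.FrobeniusClosingPatchingRelPerfectMonomialRungClosedPointTower
import Summits.ResolutionOfSingularities.ResolutionOfSingularities.Theorems.FrobeniusClosingPatchingRelPerfectDepthOneTowerContractionHolds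
import HarnessLib

/-!
# Crux `PatchingRelPerfect` (stmt-ResolutionOfSingularities-16161), chain w52 — THE MONOMIAL RUNG «R-mono»
# (every depth, every characteristic) BY NAME, modulo the combinatorial polyhedra game ONLY

[OURS · L1 W5.2 · TargetsF3] Assembly of res-L1-w52-plan-1's kernel-checked composition
`DepthTargets.monomial_of_targets` (p502939) with the four inputs now in the tree: M1
`monomialFormat_holds` (res-L1-w52-stub-2, p506672) · **M2 `MonomialCleanup.monomialSumPrincipalization_of_game`
(this seat, p511810: the global permissible polyhedra game principalizes every sum of monomial ideals by
strata over its cosupport)** · M3 `closedPointTower_holds` (res-D-pv-059, p503292) · D5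
`towerContraction_holds` (res-D-pv-009).  RESULT:

* `monomialConclusion_of_game : PolyhedraGame.GlobalPermissiblePolyhedraGame → DepthTargets.MonomialConclusion`
  — EVERY `𝔪`-primary MONOMIAL ideal of a regular local ring (monomial in a regular system of parameters,
  any dimension, any characteristic) has a companion `Q ⊇ 𝔪^m` with `Bl_{I·Q} Spec S` regular, modulo
  res-type-075's combinatorial target (p507620);
* `monomialConclusion_of_routeK : PolyhedraGame.RouteKTarget 1 → DepthTargets.MonomialConclusion` — the
  same modulo the Route-K form of the target (p511685, `globalPermissiblePolyhedraGame_of_routeKTarget`).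

Honest status: CONDITIONAL on the game (a `Prop` of the tree, OURS, to be discharged by res-type-075's
Route K = the tree's characteristic-zero functorial order reduction read on toric models); fact-free
otherwise; nothing here is a statement of the manuscript under review.

## References

* J. Kollár, *Lectures on Resolution of Singularities* (2007), (3.111) Step 3, Thms. 3.103/3.107. [Kollar2007]
* M. Spivakovsky, *A solution to Hironaka's polyhedra game* (1983). [Spivakovsky1983]
-/

-- `Summit.<Summit>.<Sub>.Theorems` with `Sub = Summit` (single-conjunct summit, D-0017)
set_option linter.dupNamespace false

noncomputable section

namespace Summit.ResolutionOfSingularities.ResolutionOfSingularities.Theorems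

namespace MonomialCleanup

universe u

/-- **R-mono modulo the global permissible polyhedra game**: every `𝔪`-primary monomial ideal of a
regular local ring has a companion (`DepthTargets.MonomialConclusion`), from
`DepthTargets.monomial_of_targets` with M1, M2 (= the game, this directory), M3, D5.
[cite: Kollar2007, (3.111) Step 3] -/
theorem monomialConclusion_of_game (hG : PolyhedraGame.GlobalPermissiblePolyhedraGame) :
    DepthTargets.MonomialConclusion.{u} :=
  DepthTargets.monomial_of_targets DepthTargets.monomialFormat_holds (monomialSumPrincipalization_of_game hG)
    DepthTargets.closedPointTower_holds DepthOneTargets.towerContraction_holds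

/-- **R-mono modulo the Route-K target** `PolyhedraGame.RouteKTarget 1` (res-type-075, p511685).
[cite: Kollar2007, (3.111) Step 3] -/
theorem monomialConclusion_of_routeK (hK : PolyhedraGame.RouteKTarget 1) :
    DepthTargets.MonomialConclusion.{u} :=
  monomialConclusion_of_game (PolyhedraGame.globalPermissiblePolyhedraGame_of_routeKTarget hK)

end MonomialCleanup

end Summit.ResolutionOfSingularities.ResolutionOfSingularities.Theorems

end
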